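import Mathlib
import HarnessLib
import HarnessLib.Audit
import Summits.AtomisticToContinuum.Statement

/-!
Route: ChaoticMixing

CLOSED (superseded) 2026-08-15T12:50:53Z by planner-AtomisticToContinuum-route-AtomisticToContinuum-ChaoticMixing-0 — reason: superseded:route-AtomisticToContinuum-MourreKoopman — superseded by route-AtomisticToContinuum-MourreKoopman — note: route-repair planner 2026-08-15: CLOSED as superseded (census). TRIED/FOUND: (1) crux UniformLocalMixing (stmt-0830) is false as worded on every shell (refuters g29-1/g31-0: n=0,1 free flight; centre-of-mass mode S=Σq_i with S(τ)=S(0)+τP; P-uniformity needs internal-energy thermal time); its correct. The file is kept as the record of this route; refuted decls are indexed as negative knowledge (`ledger negatives`).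

X_CM (CHAOTICITY REPLACES NOISE; it suffices to show): a UNIFORM LOCAL MIXING property of hard-ball
systems —
for n hard balls of diameter 1 in a periodic box of side ℓ (packing fraction < η₀), the billiard
flow restricted to each
(energy, momentum) shell is mixing for Hölder observables with a rate function r_ℓ(τ) → 0 that may
depend on ℓ but NOT on n
or on the shell (after the natural rescaling of time by the thermal speed), together with a TRANSFER
principle: in the
N-particle torus dynamics at hyperbolic scaling, mesoscopic blocks of microscopic size ℓ behave over
microscopic times τ
with 1 ≪ τ ≪ N^{1/3} like the closed ℓ-box dynamics up to boundary-flux errors o(1) in specific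
relative entropy.
Uniform local mixing + transfer ⇒ the one-block and two-block estimates of Yau's method for the
DETERMINISTIC dynamics ⇒
RelEntropyGronwall (route RelEntropyErgodic, stmt-AtomisticToContinuum-0780) ⇒ RelEntropyVanishing
(typed target,
shared) ⇒ HydrodynamicLimit. This is the finite-volume, quantitative substitute for GibbsErgodicity
(0779): instead of
characterising invariant measures of the infinite system, use decay of correlations of the finite
closed system, uniform in
the number of balls — the mechanism by which CanestrariLiveraniOlla2026 derived the heat equation
from a purely
deterministic (Anosov-fibre) dynamics. Lean: X_CM is informal (no billiard-flow mixing vocabulary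
for Kinetic.HardSphereFlow
in a box; definition request deferred); typed target/assembly attached from RelEntropyErgodic.

Rationale: WHY THIS LINE. The frontier result CanestrariLiveraniOlla2026 (Invent. Math., arXiv:2310.13338; lit
frontier hit #6 for
this problem) is the first hydrodynamic-type limit (heat equation) from a deterministic
Hamiltonian-like dynamics with no
noise at all: strongly chaotic internal degrees of freedom (geodesic flows in negative curvature)
plus transfer-operator /
anisotropic-Banach-space technology (BaladiDemersLiverani2017: exponential mixing of finite-horizon
Sinai billiard FLOWS)
supply the decorrelation that OVY took from noise. Hard balls ARE semi-dispersing billiards: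
complete hyperbolicity
(Simányi–Szász 1999), ergodicity for every N and typical (m_i, r) (Simanyi2013, arXiv:1007.1206 —
the Boltzmann–Sinai
ergodic hypothesis). What is missing is (α) RATES and (β) UNIFORMITY IN n. The route bets that
Euler-scale hydrodynamics
needs only mixing at a FIXED mesoscopic scale ℓ (then N → ∞ with ℓ fixed, finally ℓ → ∞ slowly), so
uniformity is needed
only over the number n ≲ η₀ℓ³ of balls that fit in an ℓ-box — a finite but n-uniform family — and
that ballistic transport
between blocks is handled by the entropy method exactly as in OVY. Imported area: smooth ergodic
theory of hyperbolic
systems with singularities (Sinai–Chernov, Young towers, Baladi–Demers–Liverani transfer operators,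
coupling à la
Chernov–Dolgopyat). brief=widen: dynamical systems proper, not probability.

RANKED CRUXES.
 2. UniformLocalMixing [informal]: mixing with an n-independent rate for n hard balls in an ℓ-box on
each conserved shell
    (n ≤ η₀ℓ³; even ANY rate uniform in the shell would be new for n ≥ 3 balls in d = 3).
 3. MixingToBlockEstimates [informal]: uniform local mixing + transfer ⇒ one-block/two-block
replacement lemmas for the
    torus dynamics at hyperbolic scaling in specific relative entropy (the CLO mechanism with the
chaotic variables being
    the transported ones; boundary flux between blocks is O(ℓ²τ) collisions vs O(ℓ³τ) inside).
 4. = RelEntropyGronwall (0780) and LargeVelocityControl (0781) of route RelEntropyErgodic, re-used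
(attached informally).
 TARGET/ASSEMBLY [typed, attached]: RelEntropyVanishing (0766); RelEntropyVanishing →
HydrodynamicLimit (0769).
KILL CRITERIA. A theorem that correlation decay rates for n balls in a fixed box necessarily
degenerate with n on the
relevant shells (e.g. mixing time ≥ c·n^k·ℓ for smooth observables of a tagged ball, unbounded in n
at fixed density) kills
crux 2 as stated; the route survives only if crux 3 can be run with such n-dependent rates (then
record the needed rate
explicitly). Non-ergodic exceptional (m, r) families à la Simányi are irrelevant (equal
masses/radii, but check that equal
radii at the given density are covered — if not, that is a kill of crux 2 for THIS system).
NOT DECOMPOSED YET: the box boundary condition (periodic vs reflecting), the Banach spaces, the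
shell desingularisation,
and the definition of the closed ℓ-box hard-ball flow as a Lean object (Kinetic.HardSphereFlow with
Torus.geometry scaled
would do; request deferred until a grounder takes crux 2).
SOURCES: CanestrariLiveraniOlla2026 (arXiv:2310.13338); BaladiDemersLiverani2017; Simanyi2013 +
arXiv:1007.1206;
BoldrighiniBunimovichSinai1983; OllaVaradhanYau1993; Yau1991; Spohn1991 I.3; Chernov–Markarian,
Chaotic Billiards (AMS 2006).

History (route lifecycle, newest last):
- 2026-08-15T12:50:54Z · CLOSED superseded — superseded:route-AtomisticToContinuum-MourreKoopman (planner-AtomisticToContinuum-route-AtomisticToContinuum-Chao)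

sub-problem: HydrodynamicLimit · status: closed(superseded) · opened planner-plan-AtomisticToContinuum-HydrodynamicLimit-0 2026-08-13T19:15:14Z · rev 1 · ledger route-AtomisticToContinuum-ChaoticMixing
GENERATED by the gate from the ledger (D-0016/17). Provers cite these decls: `theorem foo : Summit.AtomisticToContinuum.HydrodynamicLimit.Theses.ChaoticMixing.<Decl> := …` in Summits/AtomisticToContinuum/HydrodynamicLimit/Theorems/<Name>.lean.
-/

namespace Summit.AtomisticToContinuum.HydrodynamicLimit.Theses.ChaoticMixing

open scoped BigOperators Topology Manifold Classical MeasureTheory ProbabilityTheory Matrix InnerProductSpace ComplexConjugate ContinuousMap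
open Filter Set Function TopologicalSpace MeasureTheory

attribute [summit_statement] _root_.HydrodynamicLimit

/-- item stmt-AtomisticToContinuum-0766 · target · rank 0 · open · by planner
[target] X_RE: for all continuous profiles ∃ σ₀ ∀ σ<σ₀ ∀ classical hs-Euler solutions on [0,T) ∀
flows: the initial local Gibbs laws are probability measures and, if their fields converge at t=0,
then ∀ t<T ∃ activity profile a_t such that the reference local Gibbs law (a_t, u_t, θ_t) is a
probability measure whose empirical density/momentum/energy fields concentrate exponentially (≤ C
e^{-(N+1)/C}) around (ρ,ρu,E)(t), and klDiv(lawAt Φ_N (localGibbs a₀u₀θ₀) t ‖ localGibbs a_t u_t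
θ_t)/(N+1) → 0. Yau1991; OllaVaradhanYau1993 Thm 1.1 (with noise). -/
@[route_item "route-AtomisticToContinuum-ChaoticMixing"]
def RelEntropyVanishing : Prop :=
  ∀ (a₀ θ₀ : Literature.MathematicalPhysics.KineticTheory.T3 → ℝ) (u₀ : Literature.MathematicalPhysics.KineticTheory.T3 → Literature.MathematicalPhysics.KineticTheory.V3), Continuous a₀ → Continuous θ₀ → Continuous u₀ → (∀ x, 0 < a₀ x) → (∀ x, 0 < θ₀ x) → ∃ σ₀ : ℝ, 0 < σ₀ ∧ ∀ σ : ℝ, 0 < σ → σ < σ₀ → ∀ (T : ℝ) (ρ θ : ℝ → Literature.MathematicalPhysics.KineticTheory.T3 → ℝ) (u : ℝ → Literature.MathematicalPhysics.KineticTheory.T3 → Literature.MathematicalPhysics.KineticTheory.V3), Literature.MathematicalPhysics.KineticTheory.IsHardSphereEulerSolution σ T ρ u θ → ∀ Φ : (N : ℕ) → Literature.Analysis.FluidPDE.HardSphereFlow (Literature.Analysis.FluidPDE.Torus.geometry (Fin 3)) (Literature.MathematicalPhysics.KineticTheory.hsDiameter σ N) (N + 1), (∀ N, MeasureTheory.IsProbabilityMeasure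 (Literature.MathematicalPhysics.KineticTheory.localGibbsLaw σ a₀ u₀ θ₀ N (Φ N))) ∧ (Literature.MathematicalPhysics.KineticTheory.TendstoHydroFieldsAt (fun N => Literature.MathematicalPhysics.KineticTheory.localGibbsLaw σ a₀ u₀ θ₀ N (Φ N)) Φ ρ u θ 0 → ∀ t ∈ Set.Ico 0 T, ∃ a : Literature.MathematicalPhysics.KineticTheory.T3 → ℝ, (∀ N, MeasureTheory.IsProbabilityMeasure (Literature.MathematicalPhysics.KineticTheory.localGibbsLaw σ a (u t) (θ t) N (Φ N))) ∧ (∀ χ : Literature.MathematicalPhysics.KineticTheory.T3 → ℝ, Continuous χ → ∀ δ : ℝ, 0 < δ → ∃ C : ℝ, 0 < C ∧ ∀ N : ℕ, Literature.MathematicalPhysics.KineticTheory.localGibbsLaw σ a (u t) (θ t) N (Φ N) {z | δ < |Literature.MathematicalPhysics.KineticTheory.empiricalDensityField z χ - ∫ x, χ x * ρ t x|} ≤ ENNReal.ofReal (C * Real.exp (-(C⁻¹ * (N + 1)))) ∧ Literature.MathematicalPhysics.KineticTheory.localGibbsLaw σ a (u t) (θ t) N (Φ N) {z | δ < ‖Literature.MathematicalPhysics.KineticTheory.empiricalMomentumField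 z χ - ∫ x, (χ x * ρ t x) • u t x‖} ≤ ENNReal.ofReal (C * Real.exp (-(C⁻¹ * (N + 1)))) ∧ Literature.MathematicalPhysics.KineticTheory.localGibbsLaw σ a (u t) (θ t) N (Φ N) {z | δ < |Literature.MathematicalPhysics.KineticTheory.empiricalEnergyField z χ - ∫ x, χ x * Literature.MathematicalPhysics.KineticTheory.totalEnergyDensity (ρ t x) (u t x) (θ t x)|} ≤ ENNReal.ofReal (C * Real.exp (-(C⁻¹ * (N + 1))))) ∧ Filter.Tendsto (fun N : ℕ => InformationTheory.klDiv ((Φ N).lawAt (Literature.MathematicalPhysics.KineticTheory.localGibbsLaw σ a₀ u₀ θ₀ N (Φ N)) t) (Literature.MathematicalPhysics.KineticTheory.localGibbsLaw σ a (u t) (θ t) N (Φ N)) / ((N : ENNReal) + 1)) Filter.atTop (nhds 0))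

-- item stmt-AtomisticToContinuum-0830 · crux · rank 2 · closed · moot by None · by planner — informal only, no Lean statement yet:
--   [crux] UNIFORM LOCAL MIXING OF HARD BALLS: there are η₀ > 0 and, for every box size ℓ ≥ ℓ₀, a rate
--   function r_ℓ : ℝ₊ → ℝ₊ with r_ℓ(τ) → 0 as τ → ∞, such that for every n ≤ η₀ℓ³, the flow of n elastic
--   hard balls of diameter 1 and unit mass in the flat torus of side ℓ, restricted to a.e. shell {Σv_i =
--   P, Σ|v_i|²/2 = nθ·3/2} with its microcanonical (Liouville) measure and time measured in units of
--   ℓ⁰θ^{-1/2}, satisfies |∫ F·(G∘Φ_τ) − ∫F ∫G| ≤ r_ℓ(τ)·‖F‖_{C^α}‖G‖_{C^α} for α-Hölder F, G — the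
--   constant being independent of n, P, θ. Known: complete hyperbolicity (Simányi–Szász, Ann. Math.
--   1999), erg

-- item stmt-AtomisticToContinuum-0831 · support · rank 3 · closed · moot by None · by planner — informal only, no Lean statement yet:
--   [crux] MIXING ⇒ BLOCK ESTIMATES FOR THE DETERMINISTIC TORUS DYNAMICS: assume UniformLocalMixing. For
--   N+1 hard spheres of diameter ε = σ(N+1)^{-1/3} on 𝕋³ with local Gibbs data and t < T (pre-shock),
--   partition 𝕋³ into mesoscopic cubes of side ℓε; then the ONE-BLOCK estimate holds: the time average
--   over [s, s + τε] (1 ≪ τ ≪ N^{1/3}, microscopic time τ) of any local observable of a block is, in L¹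
--   of the time-s law and after averaging over blocks, within o_{ℓ,τ}(1) + O(boundary flux ~ τ/ℓ) of its
--   canonical Gibbs expectation at the block-averaged conserved quantities; and the TWO-BLOCK estimate:
--   b

-- item stmt-AtomisticToContinuum-0832 · support · rank 4 · closed · moot by None · by planner — informal only, no Lean statement yet:
--   [crux, pointer] This route re-uses RelEntropyGronwall (stmt-AtomisticToContinuum-0780) and
--   LargeVelocityControl (stmt-AtomisticToContinuum-0781) of route RelEntropyErgodic verbatim, with
--   GibbsErgodicity replaced by MixingToBlockEstimates as the input of the one-block step; no separate
--   statement — grounders should attach 0780/0781 here when they acquire signatures.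

/-- item stmt-AtomisticToContinuum-0769 · assembly · rank 1 · open · by planner
[assembly] X_RE → HydrodynamicLimit: entropy inequality μ(A) ≤ (log 2 + H(μ|λ))/log(1 + 1/λ(A))
(from Donsker–Varadhan / Mathlib klDiv API) with λ(A) ≤ C e^{-(N+1)/C} and H = o(N) gives μ(A) → 0;
μ = lawAt (Φ N) P t = P.map (flow t) turns μ{z | δ < |field z − ·|} into P{z | δ < |field (flow t z)
− ·|} (measurable_flow); the reference concentration is stated for z itself and TendstoHydroFieldsAt
at time 0 of the reference law is not needed. Zero-mass case impossible by the IsProbabilityMeasure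
clauses; take σ₀ from X_RE. -/
@[route_item "route-AtomisticToContinuum-ChaoticMixing"]
def Assembly : Prop :=
  RelEntropyVanishing → Literature.MathematicalPhysics.KineticTheory.HydrodynamicLimit

end Summit.AtomisticToContinuum.HydrodynamicLimit.Theses.ChaoticMixing
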